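import Mathlib
import HarnessLib
import Summits.HubbardSuperconductivity.HubbardSuperconductivity.Theorems.KLProgrammeKLRegimeFlowReadPrivSwap
import Summits.HubbardSuperconductivity.HubbardSuperconductivity.Theorems.KLProgrammeKLRegimeEngineLastStepReadingSwap

/-!
# Route `KLProgramme`, crux K3 — gen-8 ENGINE-FLOW child (stmt-HubbardSuperconductivity-20437 `KLRegimeEngineV17F2`), stub (C)
# `stub_twoLeg_curvature`, v2 text: «(P)-SWAP-LIT» — the «(P)-SWAP» receiver BOUND to p2 g17's literal swap identity
# `klLocalPart_flow_succ_eq_swap` (…EngineLastStepReadingSwap, p605757)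

Seat hubbard-kl-k3c3-p1 (g12; row «δμ-flow with klAngularMean constant piece»).  `twoLegReadPriv_succ_of_swap` (…FlowReadPrivSwap) takes the four-term
decomposition `ν_{n+1}(K) = δ_{n+1}(K₀) + (R + T + J)` as a hypothesis over abstract brackets.  Here the brackets are p2's LITERAL θ-functions at the flow
frames `(K₀, K) = (K_n, K_{n+1})` (bindings of p2 g17, KL STATUS 2026-08-28 04:54Z):

* (R)  `θ ↦ [SI(σ^{K_{n+1}}_{n+1} − K̂_{n+1})](k_F^{K_n} θ) − [SI(σ^{K_n}_{n+1} − K̂_n)](k_F^{K_n} θ)` — the frame response AT SCALE `n+1` read at the OLD Fermi point;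
* (T)  `θ ↦ F(k_F^{K_{n+1}} θ) − F(k_F^{K_n} θ)`, `F := SI(σ^{K_{n+1}}_{n+1}).eval + (klFlowPiece n).eval` — transport of the native final symbol plus the piece;
* (C1) `θ ↦ ν_n(K_n)(θ) − (klFlowPiece n)(k_F^{K_{n+1}} θ)` — the Jackson-remainder bracket VERBATIM (`hJ` of «(P)-STEP» p598604);

and the identity is DISCHARGED by `klLocalPart_flow_succ_eq_swap` under the volume guard `4·klFlowDeg (n+1) ≤ L` (one `ring` from p2's bracketing
`((A′ + R) + T) + J`).  Hypotheses `hRdiff/hR/hTdiff/hT/hJdiff/hJ` are then LITERALLY those of p2's `readLast_flow_jets_of_swap`; this file adds the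
mean-free conjunct, the fits and the registered conclusion:

* `twoLegReadPriv_flow_succ_of_swap_lit` — the private pair at `(K_{n+1}, n+1)`;
* `twoLegRead_flow_succ_of_swap_lit_registered` — stub (C) v2's REGISTERED pair at `(K_{n+1}, n+1)` (the driver's `hlast` at `n = nScales β`).

Bookkeeping only; no definition; nothing here asserts any stub of 20437, K3 or superconductivity.
References: BGM 2006 §2.4 (2.36)–(2.42) [cite: BenfattoGiulianiMastropietro2006].
-/

noncomputable section

namespace Summit.HubbardSuperconductivity.HubbardSuperconductivity.Theorems.KLRegimeSplit

set_option linter.dupNamespace false -- summit = problem name (single-conjunct summit), D-0017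

open Real Literature.MathematicalPhysics.QuantumLattice Literature.Probability.LatticeModels
open Literature.MathematicalPhysics.QuantumLattice.FermiRG

section Model

variable {L M : ℕ} [NeZero L] [NeZero M]

/-- **«(P)-SWAP-LIT» — the private pair at `(K_{n+1}, n+1)` from (A)-OLD-FRAME + p2's literal (R), (T), (C1) brackets** (rows `curveJetBar e• e•′ U k (n+1)`,
zero un-primed value entries) and the fits `cA + (eR + eT + eJ) ≤ cc` (primed alike), `a + (eR′0 + eT′0 + eJ′0) ≤ x₀/2`; the swap identity is discharged by
`klLocalPart_flow_succ_eq_swap` under `4·klFlowDeg (n+1) ≤ L`. -/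
theorem twoLegReadPriv_flow_succ_of_swap_lit (β U μ : ℝ) {n : ℕ} (hL : 4 * klFlowDeg (n + 1) ≤ L)
    {cA cA' eR eR' eT eT' eJ eJ' cc cc' : ℕ → ℝ} {τA a x₀ : ℝ}
    -- (A′): slice increment in the OLD frame at the new index, jets + structured value
    (hA : TwoLegCurveJetBound L M cA cA' β U μ (klFlowFrameU L M β U μ n) (n + 1))
    (hAval : ∀ θ : ℝ, |klTwoLegCurveProfile L M β U μ (klFlowFrameU L M β U μ n) (n + 1) θ - τA| ≤
      a * U ^ 2 * (4 : ℝ) ^ (-2 * ((n + 1 : ℕ) : ℤ)))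
    -- (R): frame response at scale n+1 read at the old Fermi point
    (hRdiff : ContDiff ℝ 4 fun θ : ℝ =>
      (symInterp L (fun k => klLocSelfEnergyRe L M β U μ (klFlowFrameU L M β U μ (n + 1)) (n + 1) k -
            (klFlowFrameU L M β U μ (n + 1)).eval (latticeMomentum L k))).eval (klFermiPoint μ (klFlowFrameU L M β U μ n) θ) -
        (symInterp L (fun k => klLocSelfEnergyRe L M β U μ (klFlowFrameU L M β U μ n) (n + 1) k -
            (klFlowFrameU L M β U μ n).eval (latticeMomentum L k))).eval (klFermiPoint μ (klFlowFrameU L M β U μ n) θ))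
    (hR : ∀ k ≤ 4, ∀ θ : ℝ, |iteratedDeriv k (fun θ : ℝ =>
      (symInterp L (fun k => klLocSelfEnergyRe L M β U μ (klFlowFrameU L M β U μ (n + 1)) (n + 1) k -
            (klFlowFrameU L M β U μ (n + 1)).eval (latticeMomentum L k))).eval (klFermiPoint μ (klFlowFrameU L M β U μ n) θ) -
        (symInterp L (fun k => klLocSelfEnergyRe L M β U μ (klFlowFrameU L M β U μ n) (n + 1) k -
            (klFlowFrameU L M β U μ n).eval (latticeMomentum L k))).eval (klFermiPoint μ (klFlowFrameU L M β U μ n) θ)) θ| ≤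
      curveJetBar eR eR' U k (n + 1))
    -- (T): transport of the native final symbol plus the piece between the two Fermi points
    (hTdiff : ContDiff ℝ 4 fun θ : ℝ =>
      ((symInterp L (klLocSelfEnergyRe L M β U μ (klFlowFrameU L M β U μ (n + 1)) (n + 1))).eval
            (klFermiPoint μ (klFlowFrameU L M β U μ (n + 1)) θ) +
          (klFlowPiece L M β U μ n).eval (klFermiPoint μ (klFlowFrameU L M β U μ (n + 1)) θ)) -
        ((symInterp L (klLocSelfEnergyRe L M β U μ (klFlowFrameU L M β U μ (n + 1)) (n + 1))).eval
            (klFermiPoint μ (klFlowFrameU L M β U μ n) θ) +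
          (klFlowPiece L M β U μ n).eval (klFermiPoint μ (klFlowFrameU L M β U μ n) θ)))
    (hT : ∀ k ≤ 4, ∀ θ : ℝ, |iteratedDeriv k (fun θ : ℝ =>
      ((symInterp L (klLocSelfEnergyRe L M β U μ (klFlowFrameU L M β U μ (n + 1)) (n + 1))).eval
            (klFermiPoint μ (klFlowFrameU L M β U μ (n + 1)) θ) +
          (klFlowPiece L M β U μ n).eval (klFermiPoint μ (klFlowFrameU L M β U μ (n + 1)) θ)) -
        ((symInterp L (klLocSelfEnergyRe L M β U μ (klFlowFrameU L M β U μ (n + 1)) (n + 1))).eval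
            (klFermiPoint μ (klFlowFrameU L M β U μ n) θ) +
          (klFlowPiece L M β U μ n).eval (klFermiPoint μ (klFlowFrameU L M β U μ n) θ))) θ| ≤ curveJetBar eT eT' U k (n + 1))
    -- (C1): the Jackson-remainder bracket verbatim
    (hJdiff : ContDiff ℝ 4 fun θ : ℝ => klLocalPart L M β U μ (klFlowFrameU L M β U μ n) n θ -
      (klFlowPiece L M β U μ n).eval (klFermiPoint μ (klFlowFrameU L M β U μ (n + 1)) θ))
    (hJ : ∀ k ≤ 4, ∀ θ : ℝ, |iteratedDeriv k (fun θ : ℝ => klLocalPart L M β U μ (klFlowFrameU L M β U μ n) n θ -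
      (klFlowPiece L M β U μ n).eval (klFermiPoint μ (klFlowFrameU L M β U μ (n + 1)) θ)) θ| ≤ curveJetBar eJ eJ' U k (n + 1))
    -- pure `U²` currency at `k = 0` and the three fits
    (heR0 : eR 0 = 0) (heT0 : eT 0 = 0) (heJ0 : eJ 0 = 0)
    (hfit : ∀ k, cA k + (eR k + eT k + eJ k) ≤ cc k) (hfit' : ∀ k, cA' k + (eR' k + eT' k + eJ' k) ≤ cc' k)
    (hfitO : a + (eR' 0 + eT' 0 + eJ' 0) ≤ x₀ / 2) :
    TwoLegReadJetBound L M cc cc' β U μ (klFlowFrameU L M β U μ (n + 1)) (n + 1) ∧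
      TwoLegReadOscAt L M x₀ β U μ (klFlowFrameU L M β U μ (n + 1)) (n + 1) := by
  refine twoLegReadPriv_flow_succ_of_swap β U μ
    (R := fun θ : ℝ =>
      (symInterp L (fun k => klLocSelfEnergyRe L M β U μ (klFlowFrameU L M β U μ (n + 1)) (n + 1) k -
            (klFlowFrameU L M β U μ (n + 1)).eval (latticeMomentum L k))).eval (klFermiPoint μ (klFlowFrameU L M β U μ n) θ) -
        (symInterp L (fun k => klLocSelfEnergyRe L M β U μ (klFlowFrameU L M β U μ n) (n + 1) k -
            (klFlowFrameU L M β U μ n).eval (latticeMomentum L k))).eval (klFermiPoint μ (klFlowFrameU L M β U μ n) θ))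
    (T := fun θ : ℝ =>
      ((symInterp L (klLocSelfEnergyRe L M β U μ (klFlowFrameU L M β U μ (n + 1)) (n + 1))).eval
            (klFermiPoint μ (klFlowFrameU L M β U μ (n + 1)) θ) +
          (klFlowPiece L M β U μ n).eval (klFermiPoint μ (klFlowFrameU L M β U μ (n + 1)) θ)) -
        ((symInterp L (klLocSelfEnergyRe L M β U μ (klFlowFrameU L M β U μ (n + 1)) (n + 1))).eval
            (klFermiPoint μ (klFlowFrameU L M β U μ n) θ) +
          (klFlowPiece L M β U μ n).eval (klFermiPoint μ (klFlowFrameU L M β U μ n) θ)))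
    (J := fun θ : ℝ => klLocalPart L M β U μ (klFlowFrameU L M β U μ n) n θ -
      (klFlowPiece L M β U μ n).eval (klFermiPoint μ (klFlowFrameU L M β U μ (n + 1)) θ))
    (fun θ => ?_) hA hAval hRdiff hR hTdiff hT hJdiff hJ heR0 heT0 heJ0 hfit hfit' hfitO
  rw [klLocalPart_flow_succ_eq_swap β U μ hL θ]
  ring

/-- **Stub (C) v2's REGISTERED pair at `(K_{n+1}, n+1)` from (A)-OLD-FRAME + p2's literal brackets**, fits straight to `klC4aJetC2`, `klC4aJetC′ P R`,
`2·(a + Σe′0) ≤ klReadOscC P R` — the `hlast` of «(P)-DRIVER» `twoLegRead_registered_all` at `n = nScales β`. -/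
theorem twoLegRead_flow_succ_of_swap_lit_registered {P : SplitConsts} {R' : RenConsts} (β U μ : ℝ) {n : ℕ} (hL : 4 * klFlowDeg (n + 1) ≤ L)
    {cA cA' eR eR' eT eT' eJ eJ' : ℕ → ℝ} {τA a : ℝ}
    (hA : TwoLegCurveJetBound L M cA cA' β U μ (klFlowFrameU L M β U μ n) (n + 1))
    (hAval : ∀ θ : ℝ, |klTwoLegCurveProfile L M β U μ (klFlowFrameU L M β U μ n) (n + 1) θ - τA| ≤
      a * U ^ 2 * (4 : ℝ) ^ (-2 * ((n + 1 : ℕ) : ℤ)))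
    (hRdiff : ContDiff ℝ 4 fun θ : ℝ =>
      (symInterp L (fun k => klLocSelfEnergyRe L M β U μ (klFlowFrameU L M β U μ (n + 1)) (n + 1) k -
            (klFlowFrameU L M β U μ (n + 1)).eval (latticeMomentum L k))).eval (klFermiPoint μ (klFlowFrameU L M β U μ n) θ) -
        (symInterp L (fun k => klLocSelfEnergyRe L M β U μ (klFlowFrameU L M β U μ n) (n + 1) k -
            (klFlowFrameU L M β U μ n).eval (latticeMomentum L k))).eval (klFermiPoint μ (klFlowFrameU L M β U μ n) θ))
    (hR : ∀ k ≤ 4, ∀ θ : ℝ, |iteratedDeriv k (fun θ : ℝ =>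
      (symInterp L (fun k => klLocSelfEnergyRe L M β U μ (klFlowFrameU L M β U μ (n + 1)) (n + 1) k -
            (klFlowFrameU L M β U μ (n + 1)).eval (latticeMomentum L k))).eval (klFermiPoint μ (klFlowFrameU L M β U μ n) θ) -
        (symInterp L (fun k => klLocSelfEnergyRe L M β U μ (klFlowFrameU L M β U μ n) (n + 1) k -
            (klFlowFrameU L M β U μ n).eval (latticeMomentum L k))).eval (klFermiPoint μ (klFlowFrameU L M β U μ n) θ)) θ| ≤
      curveJetBar eR eR' U k (n + 1))
    (hTdiff : ContDiff ℝ 4 fun θ : ℝ =>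
      ((symInterp L (klLocSelfEnergyRe L M β U μ (klFlowFrameU L M β U μ (n + 1)) (n + 1))).eval
            (klFermiPoint μ (klFlowFrameU L M β U μ (n + 1)) θ) +
          (klFlowPiece L M β U μ n).eval (klFermiPoint μ (klFlowFrameU L M β U μ (n + 1)) θ)) -
        ((symInterp L (klLocSelfEnergyRe L M β U μ (klFlowFrameU L M β U μ (n + 1)) (n + 1))).eval
            (klFermiPoint μ (klFlowFrameU L M β U μ n) θ) +
          (klFlowPiece L M β U μ n).eval (klFermiPoint μ (klFlowFrameU L M β U μ n) θ)))
    (hT : ∀ k ≤ 4, ∀ θ : ℝ, |iteratedDeriv k (fun θ : ℝ =>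
      ((symInterp L (klLocSelfEnergyRe L M β U μ (klFlowFrameU L M β U μ (n + 1)) (n + 1))).eval
            (klFermiPoint μ (klFlowFrameU L M β U μ (n + 1)) θ) +
          (klFlowPiece L M β U μ n).eval (klFermiPoint μ (klFlowFrameU L M β U μ (n + 1)) θ)) -
        ((symInterp L (klLocSelfEnergyRe L M β U μ (klFlowFrameU L M β U μ (n + 1)) (n + 1))).eval
            (klFermiPoint μ (klFlowFrameU L M β U μ n) θ) +
          (klFlowPiece L M β U μ n).eval (klFermiPoint μ (klFlowFrameU L M β U μ n) θ))) θ| ≤ curveJetBar eT eT' U k (n + 1))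
    (hJdiff : ContDiff ℝ 4 fun θ : ℝ => klLocalPart L M β U μ (klFlowFrameU L M β U μ n) n θ -
      (klFlowPiece L M β U μ n).eval (klFermiPoint μ (klFlowFrameU L M β U μ (n + 1)) θ))
    (hJ : ∀ k ≤ 4, ∀ θ : ℝ, |iteratedDeriv k (fun θ : ℝ => klLocalPart L M β U μ (klFlowFrameU L M β U μ n) n θ -
      (klFlowPiece L M β U μ n).eval (klFermiPoint μ (klFlowFrameU L M β U μ (n + 1)) θ)) θ| ≤ curveJetBar eJ eJ' U k (n + 1))
    (heR0 : eR 0 = 0) (heT0 : eT 0 = 0) (heJ0 : eJ 0 = 0)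
    (hfit : ∀ k, cA k + (eR k + eT k + eJ k) ≤ klC4aJetC2 k) (hfit' : ∀ k, cA' k + (eR' k + eT' k + eJ' k) ≤ klC4aJetC' P R' k)
    (hfitO : 2 * (a + (eR' 0 + eT' 0 + eJ' 0)) ≤ klReadOscC P R') :
    TwoLegReadJetBound L M klC4aJetC2 (klC4aJetC' P R') β U μ (klFlowFrameU L M β U μ (n + 1)) (n + 1) ∧
      TwoLegReadOscAt L M (klReadOscC P R') β U μ (klFlowFrameU L M β U μ (n + 1)) (n + 1) :=
  twoLegReadPriv_flow_succ_of_swap_lit β U μ hL hA hAval hRdiff hR hTdiff hT hJdiff hJ heR0 heT0 heJ0 hfit hfit' (by linarith)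

end Model

end Summit.HubbardSuperconductivity.HubbardSuperconductivity.Theorems.KLRegimeSplit

end
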